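import Summits.BirchSwinnertonDyer.BirchSwinnertonDyer.Theorems.ClassRecordThreeCornerAtThreeControlOfFacts
import Summits.BirchSwinnertonDyer.Rank1Residual.X11b.Three.CornerSplitResidualHull
import HarnessLib

/-!
# Route `ClassRecordThree` (rung K2@3), crux 7 `CornerAtThree` (item stmt-BirchSwinnertonDyer-19111): the split
# corner's GZ-currency HULL versus the three inputs of record — x11b3's lead deal #6 (R6-2) bridge with its labelled
# control hypothesis `hCTL` DISCHARGED (cell `bsd-stepL`, width-lever second lane `bsd-stepL-corner3-p2`;
# `--supports stmt-BirchSwinnertonDyer-19111`)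

HONEST FRAMING: theorems only (no definition, no named fact, no `sorry`); CONDITIONAL on cited Literature facts taken BY
NAME; nothing is asserted about any curve; item 19111 stays open; BSD is not advanced; no census word, tier or label
moves (T7).

## What this file proves

x11b3-p8's `X11b/Three/CornerSplitResidualHull.lean` showed, on a split-corner pair (`ClassX11b W 3 ∧ ¬ Surj W 3 ∧
split(3)`), that the hull `CornerSplitResidualAt W` (GZ currency) is EQUIVALENT to the three inputs of record
`CornerStepLAt W ∧ CornerTwistAt W ∧ CornerUpperAt W` — GIVEN the control identity `ControlOnTreeAt 3 κ 𝔭 γ embAt P` at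
the corner's odd Heegner data, carried as the LABELLED HYPOTHESIS `hCTL` ("in the tree a THEOREM only on (ram) ∧ 3 ∤ ∏c ∧
locally-trivial pairs, NOT on the corner (¬Ram, 3 ∣ c₃)"). This lane's `X11b.controlOnTreeAt_of_mult_of_rankOne_odd`
(p528380: the identity at EVERY multiplicative rank-one datum, odd `p`, image-free, torsion-free, from GZK, newforms and
the two Poitou–Tate facts) discharges `hCTL` at every frame where it is consumed (there `ClassX11b W 3` and
`L(E^{d_K},1) ≠ 0` are in scope):

* `Three.cornerStepLAt_of_cornerSplitResidualAt_of_facts` — hull ⟹ (L) `CornerStepLAt W`, modulo Gross–Zagier,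
  Kolyvagin, modularity (finiteness of `Ш(E/K)`) + GZK, newforms, Poitou–Tate ×2 (control). No labelled hypothesis left.
* **`Three.cornerSplitResidualAt_iff_cornerInputs_of_facts`** — THE BRIDGE of deal #6 (R6-2) modulo published ∕ cited
  facts ONLY: on a split-corner pair, `CornerSplitResidualAt W ↔ CornerStepLAt W ∧ CornerTwistAt W ∧ CornerUpperAt W`.
  So the hull is now an input-of-record substitute for ALL THREE conjuncts of crux `CornerAtThree` on the split corner.

References: [Castella2018] Thm. 2.3 (arXiv:1704.06608 p. 5); [JetchevSkinnerWan2017] Thm. 3.3.1, §7.4.1; [GrossLMS1991]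
§2 Conj. (2.2); [Miller2011LMS] Def. 1.1; tree `X11b/Three/CornerSplitResidualHull.lean` (x11b3-p8).
-/

noncomputable section

open scoped Classical

open WeierstrassCurve NumberField IsDedekindDomain Field Literature.NumberTheory.EllipticCurves
  Rat.HeightOneSpectrum
  Literature.NumberTheory.DiophantineGeometry
  Literature.NumberTheory.EllipticCurves.GreenbergSelmer
  Literature.NumberTheory.EllipticCurves.ModularForms
  Literature.NumberTheory.EllipticCurves.Rank1Residual
  Literature.NumberTheory.EllipticCurves.Rank1Residual.Typed
  Literature.NumberTheory.QuadraticFields.Quadratic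
  Literature.NumberTheory.GaloisRepresentations Literature.NumberTheory.GaloisCohomology
  Summit.BirchSwinnertonDyer.Rank1Residual
  Summit.BirchSwinnertonDyer.Rank1Residual.X11b.AcSelmer
  Summit.BirchSwinnertonDyer.Rank1Residual.X11b.LocBridge

namespace Summit.BirchSwinnertonDyer.Rank1Residual.X11b.Three

/-- **Hull ⟹ (L) with the control identity DISCHARGED.** On a split-corner pair, `CornerSplitResidualAt W →
CornerStepLAt W` modulo cited facts only: x11b3-p8's `cornerStepLAt_of_cornerSplitResidualAt_of_control` with `hCTL`
supplied, at each corner frame, by `controlOnTreeAt_of_mult_of_rankOne_odd` (`r_an = 1`, `3 ≠ 2`, `Mult W 3` from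
`ClassX11b W 3`; `3 ∣ N_E` splits in the Heegner field). [cite: Castella2018, Thm. 2.3 (arXiv:1704.06608 p. 5)]
[cite: JetchevSkinnerWan2017, Thm. 3.3.1 and §7.4.1 (eq:shalowerK-1) (arXiv:1512.06894 pp. 11, 30)] -/
theorem cornerStepLAt_of_cornerSplitResidualAt_of_facts [Fact (Nat.Prime 3)]
    (hGZ : ∀ (N : ℕ) [NeZero N] (W : WeierstrassCurve ℚ) (K : Type) [Field K] [NumberField K],
      gross_zagier N W K)
    (hKo : ∀ (N : ℕ) [NeZero N] (W : WeierstrassCurve ℚ) (K : Type) [Field K] [NumberField K],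
      kolyvagin N W K)
    (hmod : hasEntireLFunction_rat)
    (hGZK : rank_eq_analyticRank_of_analyticRank_le_one) (hnf : exists_isNewformOf)
    (hPT : ∀ (K : Type) [Field K] [NumberField K], poitouTate_selmerStructure_duality K)
    (hPT2 : ∀ (K : Type) [Field K] [NumberField K], poitouTate_sha_tateDual K)
    (W : WeierstrassCurve ℚ) [W.IsElliptic] [W.IsGloballyMinimal]
    (hs : W.HasSplitMultiplicativeReductionAtPrime 3)
    (hR : CornerSplitResidualAt W) : CornerStepLAt W := by
  intro N _ K _ _ Dt H ι P hX hns hN hK hodd hHN hLt hP hc hPinf κ hκ γ _ 𝔭 h𝔭 he hf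
  obtain ⟨hr, hp2, hmult, -⟩ := id hX
  have hpN : 3 ∣ N := hN ▸ dvd_conductorNorm_of_mult hmult
  have hsplit : SplitsIn K 3 := hHN 3 Fact.out hpN
  have hD0 : (NumberField.discr K : ℚ) ≠ 0 := by exact_mod_cast NumberField.discr_ne_zero K
  haveI hEt : (W.quadraticTwist (NumberField.discr K : ℚ)).IsElliptic :=
    W.isElliptic_quadraticTwist hD0
  obtain ⟨Cd, hCd⟩ := hasGlobalMinimalModel_rat_holds (W.quadraticTwist (NumberField.discr K : ℚ))
  haveI := hCd
  haveI hfinK : Finite (W.baseChange K).sha :=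
    finite_sha_baseChange_of_heegner W N K Dt H ι P (hGZ N W K) (hKo N W K) hmod hr hK hHN hLt hP
  obtain ⟨hL, -, -⟩ := hR hX hns hs N K Dt H ι P (Cd • W.quadraticTwist (NumberField.discr K : ℚ)) Cd
    hN hK hodd hHN hLt hP hc hPinf hfinK rfl
  exact imcLowerWaldspurgerOnTreeAt_of_controlOnTreeAt_of_indexLowerBoundAt_prime hK hN hHN
    (controlOnTreeAt_of_mult_of_rankOne_odd W 3 hGZK hnf hPT hPT2 hp2 hmult hr hK hsplit hLt P hPinf κ hκ γ 𝔭
      h𝔭 he hf) hL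

/-- **THE BRIDGE of deal #6 (R6-2) modulo published ∕ cited facts ONLY: on a split-corner pair,
`CornerSplitResidualAt W ↔ CornerStepLAt W ∧ CornerTwistAt W ∧ CornerUpperAt W`.** x11b3-p8's
`cornerSplitResidualAt_iff_cornerInputs_of_control` with its labelled hypothesis `hCTL` discharged by
`cornerStepLAt_of_cornerSplitResidualAt_of_facts`. Facts: Gross–Zagier, Kolyvagin, GZK, modularity, newform, Mazur 1978
Cor. 4.1, Poitou–Tate (three forms), local Euler characteristic. [cite: GrossLMS1991, §2 Conj. (2.2)]
[cite: Castella2018, Thm. 2.3 (arXiv:1704.06608 p. 5)] [cite: Miller2011LMS, Def. 1.1] -/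
theorem cornerSplitResidualAt_iff_cornerInputs_of_facts [Fact (Nat.Prime 3)]
    (hGZ : ∀ (N : ℕ) [NeZero N] (W : WeierstrassCurve ℚ) (K : Type) [Field K] [NumberField K],
      gross_zagier N W K)
    (hKo : ∀ (N : ℕ) [NeZero N] (W : WeierstrassCurve ℚ) (K : Type) [Field K] [NumberField K],
      kolyvagin N W K)
    (hGZK : rank_eq_analyticRank_of_analyticRank_le_one) (hmod : hasEntireLFunction_rat)
    (hnf : exists_isNewformOf) (hMaz : mazur_not_dvd_maninConstant_of_odd)
    (hPT0 : ∀ (K : Type) [Field K] [NumberField K], poitouTate_sum_localTatePairing_eq_zero K)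
    (hPT : ∀ (K : Type) [Field K] [NumberField K], poitouTate_selmerStructure_duality K)
    (hPT2 : ∀ (K : Type) [Field K] [NumberField K], poitouTate_sha_tateDual K)
    (hEP : ∀ (K : Type) [Field K] [NumberField K] (v : HeightOneSpectrum (𝓞 K)),
      localEulerPoincareCharacteristic (v.adicCompletion K))
    (W : WeierstrassCurve ℚ) [W.IsElliptic] [W.IsGloballyMinimal]
    (hs : W.HasSplitMultiplicativeReductionAtPrime 3) :
    CornerSplitResidualAt W ↔ CornerStepLAt W ∧ CornerTwistAt W ∧ CornerUpperAt W :=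
  ⟨fun hR ↦ ⟨cornerStepLAt_of_cornerSplitResidualAt_of_facts hGZ hKo hmod hGZK hnf hPT hPT2 W hs hR,
      cornerTwistAt_of_cornerSplitResidualAt hGZ hKo hGZK hmod hnf hMaz W hs hR,
      cornerUpperAt_of_cornerSplitResidualAt W hs hR⟩,
    fun ⟨hSL, hTw, hU⟩ ↦ cornerSplitResidualAt_of_cornerInputs hGZ hKo hGZK hmod hPT0 hEP W hSL hTw hU⟩

end Summit.BirchSwinnertonDyer.Rank1Residual.X11b.Three

end
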